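import Summits.QuantumFields.BalabanUV.Beta.D1BFx.RoadEndBFxRecutSbpS
import Summits.QuantumFields.BalabanUV.Beta.D1BFx.RoadEndBFxRecutTails

/-!
# `BalabanUV.Beta.D1BFx.RoadEndBFxRecutTailsSbpS` — road «BF-x» for binder row D1: THE PER-WORD END «ENDₛ» ABOVE THE SUMMATION-BY-PARTS WALL WITH
# d0∕d1 AND THE (α)-LEAF FROM THE PRINTED STATEMENTS — **NO LEG ROW AT ALL** (+ the ray END: no leg row and no Ward row)

HONEST DEPENDENCY (page 1, mandatory): continuum YM on T⁴ ⇐ BetaPertH ∧ nine spine estimates (0/9 proved); BetaPertH ⇐ (D1) ∧ (D4) ∧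
CAP+tail; G-an2-4 gates asym, D1 and NE2/3/4.  HONEST FRAMING (cell contract, verbatim): «discharging `BetaPertH` makes Bałaban's UV
stability UNCONDITIONAL — a real constructive-QFT result; it is NOT the continuum limit and NOT the Clay problem.»  THIS MODULE DISCHARGES
NOTHING of the wall: [folklore] composition BY NAME of `RoadEndBFxRecutSbpS.d1Drift_BFx_recut_sbpS` ∕ `d1Drift_BFx_recut_ray_sbpS` with
`FrozenLegTails.far_rows_d0_d1_of_prop12` and `GluonLegTails.hGa_of_prop12` (CONDITIONAL on `h12`∕`h126` BY NAME); the record's `tailConst` is reused.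
No `def`, nothing cited, 0 sorry.  0 wall binders (hW ∕ hR-sockets ∕ hSX-socket ∕ D1Tel ∕ D1Rep = 0); NOT (K), NOT D1, NOT `BetaPertH`, NOT continuum, NOT Clay.

ABSOLUTE RULE (cell charter, verbatim): «No internally-minted statement may enter as a cited fact. Every hypothesis is either kernel-proved in
this package or a verbatim quotation of a PUBLISHED theorem with page reference. The manuscript(s) under audit are NOT citable for their own
disputed steps — they are the thing under adjudication; programme-internal (2001/route/tribunal) claims are never citable.»

WHY (road owner d1-p2 gen 13, «C3-SBP»; `LEAVES-BFx.md` INTEGRATION #35).  The per-word END of record with tails,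
`RoadEndBFxRecutTailsS.d1Drift_BFx_recut_shell_of_prop12S`, still displays the shell rows `h2s` (constant `D₂`) and `d2s` (rate `δ₂`, constant `A₂`) of the
frozen profile.  Above the owner's summation-by-parts wall (`SbpScalarEnd.d1Drift_of_strongRoad_sbp`) those rows are not read, and the two remaining
exterior rows d0∕d1 are `FrozenLegTails.far_rows_d0_d1_of_prop12` — so the per-word END now displays NO leg row: its leg-side inputs are exactly the two
PRINTED statements [B5, Prop. 1.2] (`h12`) and [B5, (1.126)–(1.127)] (`h126`), BY NAME, as hypotheses.

CONTENT.
* §2 [folklore] **`d1Drift_BFx_recut_sbp_of_prop12S`** — `d1Drift_BFx_recut_shell_of_prop12S` minus `hD₂ hA₂ hδ₂ h2s d2s` (displayed: `h12 h126 hB1 hK s hωs hlam`, the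
  slot-table sockets, `hdiv`, `hrowgh`, (REST′) off the corner, (U)).
* §3 [folklore] **`d1Drift_BFx_recut_ray_sbp_of_prop12S`** — the same on the ghost Ward ray `(x₀, cK, cQ) := (−cgh n, cgh n·n², cgh n·a)` with `hrowgh` ALSO
  discharged (`RoadEndBFxRecutSbpS.d1Drift_BFx_recut_ray_sbpS`): NO leg row and NO Ward row.
Unit `b2b-balaban-beta-d1-formalise-leaf-04` (gen 15), D1 formalisation swarm, per-word lane; owner OFFER journal l.35219; `LEAVES-BFx.md` row «C3-SBP».
-/

noncomputable section

open Finset Filter Topology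
open scoped BigOperators
open Literature.MathematicalPhysics.QuantumFieldTheory.Balaban1983to89
open Literature.MathematicalPhysics.QuantumFieldTheory.Balaban1983to89.Beta
open OneStepResolventKernel (JetData)
open OneStepKernelFamily (TbalOf D1Drift)
open WindowIdentification (fullSum)
open DyadicShell (Pt supNorm)
open ExpKernelCalculus (Site BiLoc shiftK)
open BubbleTransfer (unitVec)
open DressedMomentNormalisation (resSite)
open VectorTailsLoc (fam kfam)
open Summit.QuantumFields.BalabanUV.Beta.TameKernelCalculus (Spr)
open Summit.QuantumFields.BalabanUV.Beta.D1BFx.GluonLeg (Ga)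
open Summit.QuantumFields.BalabanUV.Beta.D1BFx.ReducedKernel (TableR TOfRed)
open Summit.QuantumFields.BalabanUV.Beta.D1BFx.DressedTadpoleTable (tableRed)
open Summit.QuantumFields.BalabanUV.Beta.D1BFx.ReducedKernelSandwich (fineHess)
open Summit.QuantumFields.BalabanUV.Beta.D1BFx.FineStencilBFBalaban (SbfBal)
open Summit.QuantumFields.BalabanUV.Beta.D1BFx.SecondStencilBF (Wbf)
open Summit.QuantumFields.BalabanUV.Beta.D1BFx.GhostKernelComplete (PghQ fineHessGhQ)
open Summit.QuantumFields.BalabanUV.Beta.D1BFx.FrozenLegProfile (gfrz)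
open Summit.QuantumFields.BalabanUV.Beta.D1BFx.SplitInstance (RestIdx)
open Summit.QuantumFields.BalabanUV.Beta.D1BFx.SplitInstanceS (restKS)
open Summit.QuantumFields.BalabanUV.Beta.D1BFx.RoadEndBFxRecut (cornerIdx)
open Summit.QuantumFields.BalabanUV.Beta.D1BFx.RoadEndBFxRecutSbpS (d1Drift_BFx_recut_sbpS d1Drift_BFx_recut_ray_sbpS)
open Summit.QuantumFields.BalabanUV.Beta.D1BFx.RoadEndBFxRecutTails (tailConst tailConst_nonneg)
open Summit.QuantumFields.BalabanUV.Beta.D1BFx.FrozenLegTails (nOf MOf hn1 far_rows_d0_d1_of_prop12)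
open Summit.QuantumFields.BalabanUV.Beta.D1BFx.GluonLegTails (hGa_of_prop12)

namespace Summit.QuantumFields.BalabanUV.Beta.D1BFx.RoadEndBFxRecutTailsSbpS

/-! ## §2 The road END above the summation-by-parts wall with d0∕d1 discharged modulo the printed B5 statements: no leg row -/

variable {Lc : ℕ} [NeZero Lc] {a N : ℝ} {μ ν : Fin 4} {υ : Type*} [Fintype υ]
  {cE cVH cΛ cR cK cQ cgh cE₂ cJ4 cΛ₂ cR₂ cQ₂ x₀ ωgl ωgh : ℕ → ℝ} {WE WJ WΛ WR WQ : ℕ → TableR} {CE CJ CΛ CRt CQ δW : ℕ → ℝ}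
  {Ru : υ → ℕ → ℝ} {CU : υ → ℝ} {CR : RestIdx → ℝ} {U₁ : ℝ}

/-- [folklore] **ROAD BF-x «ENDₛ», END TO END, RE-CUT TABLE AT `gfrz`, ABOVE THE SUMMATION-BY-PARTS WALL, EXTERIOR ROWS d0∕d1 AND `Spr (Ga n a)` FROM
[B5, Prop. 1.2] ∧ [B5, (1.126)–(1.127)] BY NAME — NO LEG ROW DISPLAYED.**  `RoadEndBFxRecutSbpS.d1Drift_BFx_recut_sbpS` with the rows d0∕d1 supplied by
`FrozenLegTails.far_rows_d0_d1_of_prop12` (envelope `tailConst A₀ A₁ 0`, rate `δ₁`) and the (α)-leaf `hGa` by `GluonLegTails.hGa_of_prop12`, from the two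
printed statements `h12`∕`h126` (hypotheses, NOT proved here) — i.e. the record's `RoadEndBFxRecutTailsS.d1Drift_BFx_recut_shell_of_prop12S` with
`hD₂ hA₂ hδ₂ h2s d2s` DELETED; B1, (K) `hK` + `s`∕`hωs` + `hlam`, the slot-table sockets, `hdiv`, `hrowgh`, (REST′) off the corner and (U) remain displayed —
verbatim, same order. -/
theorem d1Drift_BFx_recut_sbp_of_prop12S (Js : ℕ → JetData 3 Lc) (hμν : μ ≠ ν) (hN : N ≠ 0) (hL : 2 ≤ Lc) (hodd : Odd Lc) (ha : 0 < a)
    (c : ℕ → ℝ)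
    -- the two PRINTED statements, by name, for the family scale × even cubic volumes
    (h12 : B5.Prop12Printed (fam nOf hn1 MOf a ha)) (h126 : B5.Kernel126_127Printed (kfam nOf MOf))
    -- bridge B1
    (hB1 : ∀ m : ℕ, 1 ≤ m → |(∑ j ∈ range m, B12Beta.secondMoment (TbalOf Lc Js j) μ ν) - c (Lc ^ m)| ≤ U₁)
    -- slot (K) with the loop-weight ratio and the PINNED normalisation (the (α)-leaf `Spr (Ga n a)` is `GluonLegTails.hGa_of_prop12`)
    (hK : ∀ n : ℕ, 2 ≤ n → Odd n → ∀ [NeZero n], c n =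
      ωgl n * B12Beta.secondMoment (TOfRed n a (SbfBal n a (cE n) (cVH n) (cΛ n) (cR n) (cK n) (cQ n))
        (tableRed n (Wbf (cE₂ n) (cJ4 n) (cΛ₂ n) (cR₂ n) (cQ₂ n) (WE n) (WJ n) (WΛ n) (WR n) (WQ n)))) μ ν
      + ωgh n * B12Beta.secondMoment (PghQ n a (x₀ n) (cK n) (cQ n)) μ ν + ∑ u, Ru u n)
    (s : ℕ → ℝ) (hωs : ∀ n : ℕ, 2 ≤ n → ωgh n * (s n * cK n) ^ 2 = -2 * (ωgl n * cE n ^ 2))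
    (hlam : ∀ n : ℕ, 2 ≤ n → ωgl n * cE n ^ 2 = 2 * N ^ 2 * (n : ℝ) ^ 8)
    -- slot-table sockets
    (hδW : ∀ n, 0 < δW n)
    (hE : ∀ n κ u l u', BiLoc (WE n κ u l u') u u' (CE n) (δW n)) (hJ : ∀ n κ u l u', BiLoc (WJ n κ u l u') u u' (CJ n) (δW n))
    (hΛ : ∀ n κ u l u', BiLoc (WΛ n κ u l u') u u' (CΛ n) (δW n)) (hR : ∀ n κ u l u', BiLoc (WR n κ u l u') u u' (CRt n) (δW n))
    (hQ : ∀ n κ u l u', BiLoc (WQ n κ u l u') u u' (CQ n) (δW n))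
    (hEc : ∀ (n : ℕ) (κ : Fin 4) (u : Site 4) (l : Fin 4) (u' t : Site 4),
      WE n κ (u + (n : ℤ) • t) l (u' + (n : ℤ) • t) = shiftK (-((n : ℤ) • t)) (WE n κ u l u'))
    (hJc : ∀ (n : ℕ) (κ : Fin 4) (u : Site 4) (l : Fin 4) (u' t : Site 4),
      WJ n κ (u + (n : ℤ) • t) l (u' + (n : ℤ) • t) = shiftK (-((n : ℤ) • t)) (WJ n κ u l u'))
    (hΛc : ∀ (n : ℕ) (κ : Fin 4) (u : Site 4) (l : Fin 4) (u' t : Site 4),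
      WΛ n κ (u + (n : ℤ) • t) l (u' + (n : ℤ) • t) = shiftK (-((n : ℤ) • t)) (WΛ n κ u l u'))
    (hRc : ∀ (n : ℕ) (κ : Fin 4) (u : Site 4) (l : Fin 4) (u' t : Site 4),
      WR n κ (u + (n : ℤ) • t) l (u' + (n : ℤ) • t) = shiftK (-((n : ℤ) • t)) (WR n κ u l u'))
    (hQc : ∀ (n : ℕ) (κ : Fin 4) (u : Site 4) (l : Fin 4) (u' t : Site 4),
      WQ n κ (u + (n : ℤ) • t) l (u' + (n : ℤ) • t) = shiftK (-((n : ℤ) • t)) (WQ n κ u l u'))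
    (hEs : ∀ n κ u l u', WE n κ u l u' = WE n l u' κ u) (hJs : ∀ n κ u l u', WJ n κ u l u' = WJ n l u' κ u)
    (hΛs : ∀ n κ u l u', WΛ n κ u l u' = WΛ n l u' κ u) (hRs : ∀ n κ u l u', WR n κ u l u' = WR n l u' κ u)
    (hQs : ∀ n κ u l u', WQ n κ u l u' = WQ n l u' κ u)
    -- first-bond divergence-freeness of the gluon fine Hessian kernel; the ghost Ward rows
    (hdiv : ∀ n : ℕ, 2 ≤ n → ∀ [NeZero n], ∀ (l' : Fin 4) (u' u : Site 4), ∑ κ' : Fin 4,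
      (fineHess n a (SbfBal n a (cE n) (cVH n) (cΛ n) (cR n) (cK n) (cQ n))
          (Wbf (cE₂ n) (cJ4 n) (cΛ₂ n) (cR₂ n) (cQ₂ n) (WE n) (WJ n) (WΛ n) (WR n) (WQ n)) κ' l' (u - Pi.single κ' 1) u'
        - fineHess n a (SbfBal n a (cE n) (cVH n) (cΛ n) (cR n) (cK n) (cQ n))
          (Wbf (cE₂ n) (cJ4 n) (cΛ₂ n) (cR₂ n) (cQ₂ n) (WE n) (WJ n) (WΛ n) (WR n) (WQ n)) κ' l' u u') = 0)
    (hrowgh : ∀ n : ℕ, 2 ≤ n → ∀ [NeZero n], ∀ (κ' l' : Fin 4) (b : Site 4), HasSum (fineHessGhQ n a (x₀ n) (cK n) (cQ n) κ' l' b) 0)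
    -- (REST′) for the re-cut words other than the corner, n-UNIFORM; (U)
    (hRest : ∀ n : ℕ, 2 ≤ n → ∀ [NeZero n], ∀ τ : RestIdx, τ ≠ cornerIdx →
      |∑ b ∈ (univ : Finset (Fin 4 → Fin n)).image resSite, ((n : ℝ) ^ 4)⁻¹ *
        fullSum (fun w : Pt => restKS n a (gfrz n a b) (fun v => s n * gfrz n a b v) (cE n) (cΛ n) (cR n) (cK n) (cQ n) (cE₂ n) (cJ4 n) (cΛ₂ n) (cR₂ n) (cQ₂ n) (x₀ n)
          (WE n) (WJ n) (WΛ n) (WR n) (WQ n) (ωgl n) (ωgh n) ((n : ℝ) ^ 8) N μ ν b τ w)| ≤ CR τ)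
    (hU : ∀ n : ℕ, 2 ≤ n → ∀ u, |Ru u n| ≤ CU u) :
    D1Drift Lc Js N μ ν := by
  obtain ⟨δ₁, A₀, A₁, hδ₁, hA₀, hA₁, hd0, hd1⟩ := far_rows_d0_d1_of_prop12 ha h12 h126
  exact d1Drift_BFx_recut_sbpS (A := tailConst A₀ A₁ 0) (δ := δ₁) Js hμν hN hL hodd ha c (tailConst_nonneg hA₀ hA₁ le_rfl) hδ₁ hd0 hd1 hB1
    (hGa_of_prop12 ha h12 h126) hK s hωs hlam hδW hE hJ hΛ hR hQ hEc hJc hΛc hRc hQc hEs hJs hΛs hRs hQs hdiv hrowgh hRest hU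

/-! ## §3 The RAY END: no leg row and no Ward row -/

/-- [folklore] **ROAD BF-x «ENDₛ», END TO END, RE-CUT TABLE AT `gfrz`, GHOST WEIGHTS ON THE WARD RAY `(x₀, cK, cQ) := (−cgh n, cgh n·n², cgh n·a)`, ABOVE THE
SUMMATION-BY-PARTS WALL — NO LEG ROW AND NO WARD ROW DISPLAYED.**  `RoadEndBFxRecutSbpS.d1Drift_BFx_recut_ray_sbpS` (whose `hrowgh` is the theorem
`GhostKernelComplete.hasSum_row_fineHessGhQ_ray`) with d0∕d1 from `FrozenLegTails.far_rows_d0_d1_of_prop12` and `hGa` from `GluonLegTails.hGa_of_prop12`.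
Displayed, verbatim: the two printed statements `h12`∕`h126` (hypotheses), B1 `hB1`, (K) `hK` at the ray + `s`∕`hωs` + `hlam`, the slot-table sockets, `hdiv`
at the ray, (REST′) off the corner for the words `restKS (gfrz n a b) (s n • gfrz n a b)` at the ray letters, (U). -/
theorem d1Drift_BFx_recut_ray_sbp_of_prop12S (Js : ℕ → JetData 3 Lc) (hμν : μ ≠ ν) (hN : N ≠ 0) (hL : 2 ≤ Lc) (hodd : Odd Lc) (ha : 0 < a)
    (c : ℕ → ℝ)
    -- the two PRINTED statements, by name, for the family scale × even cubic volumes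
    (h12 : B5.Prop12Printed (fam nOf hn1 MOf a ha)) (h126 : B5.Kernel126_127Printed (kfam nOf MOf))
    -- bridge B1
    (hB1 : ∀ m : ℕ, 1 ≤ m → |(∑ j ∈ range m, B12Beta.secondMoment (TbalOf Lc Js j) μ ν) - c (Lc ^ m)| ≤ U₁)
    -- slot (K) AT THE RAY with the loop-weight ratio and the PINNED normalisation (the (α)-leaf `Spr (Ga n a)` is `GluonLegTails.hGa_of_prop12`)
    (hK : ∀ n : ℕ, 2 ≤ n → Odd n → ∀ [NeZero n], c n =
      ωgl n * B12Beta.secondMoment (TOfRed n a (SbfBal n a (cE n) (cVH n) (cΛ n) (cR n) (cgh n * (n : ℝ) ^ 2) (cgh n * a))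
        (tableRed n (Wbf (cE₂ n) (cJ4 n) (cΛ₂ n) (cR₂ n) (cQ₂ n) (WE n) (WJ n) (WΛ n) (WR n) (WQ n)))) μ ν
      + ωgh n * B12Beta.secondMoment (PghQ n a (-cgh n) (cgh n * (n : ℝ) ^ 2) (cgh n * a)) μ ν + ∑ u, Ru u n)
    (s : ℕ → ℝ) (hωs : ∀ n : ℕ, 2 ≤ n → ωgh n * (s n * (cgh n * (n : ℝ) ^ 2)) ^ 2 = -2 * (ωgl n * cE n ^ 2))
    (hlam : ∀ n : ℕ, 2 ≤ n → ωgl n * cE n ^ 2 = 2 * N ^ 2 * (n : ℝ) ^ 8)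
    -- slot-table sockets
    (hδW : ∀ n, 0 < δW n)
    (hE : ∀ n κ u l u', BiLoc (WE n κ u l u') u u' (CE n) (δW n)) (hJ : ∀ n κ u l u', BiLoc (WJ n κ u l u') u u' (CJ n) (δW n))
    (hΛ : ∀ n κ u l u', BiLoc (WΛ n κ u l u') u u' (CΛ n) (δW n)) (hR : ∀ n κ u l u', BiLoc (WR n κ u l u') u u' (CRt n) (δW n))
    (hQ : ∀ n κ u l u', BiLoc (WQ n κ u l u') u u' (CQ n) (δW n))
    (hEc : ∀ (n : ℕ) (κ : Fin 4) (u : Site 4) (l : Fin 4) (u' t : Site 4),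
      WE n κ (u + (n : ℤ) • t) l (u' + (n : ℤ) • t) = shiftK (-((n : ℤ) • t)) (WE n κ u l u'))
    (hJc : ∀ (n : ℕ) (κ : Fin 4) (u : Site 4) (l : Fin 4) (u' t : Site 4),
      WJ n κ (u + (n : ℤ) • t) l (u' + (n : ℤ) • t) = shiftK (-((n : ℤ) • t)) (WJ n κ u l u'))
    (hΛc : ∀ (n : ℕ) (κ : Fin 4) (u : Site 4) (l : Fin 4) (u' t : Site 4),
      WΛ n κ (u + (n : ℤ) • t) l (u' + (n : ℤ) • t) = shiftK (-((n : ℤ) • t)) (WΛ n κ u l u'))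
    (hRc : ∀ (n : ℕ) (κ : Fin 4) (u : Site 4) (l : Fin 4) (u' t : Site 4),
      WR n κ (u + (n : ℤ) • t) l (u' + (n : ℤ) • t) = shiftK (-((n : ℤ) • t)) (WR n κ u l u'))
    (hQc : ∀ (n : ℕ) (κ : Fin 4) (u : Site 4) (l : Fin 4) (u' t : Site 4),
      WQ n κ (u + (n : ℤ) • t) l (u' + (n : ℤ) • t) = shiftK (-((n : ℤ) • t)) (WQ n κ u l u'))
    (hEs : ∀ n κ u l u', WE n κ u l u' = WE n l u' κ u) (hJs : ∀ n κ u l u', WJ n κ u l u' = WJ n l u' κ u)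
    (hΛs : ∀ n κ u l u', WΛ n κ u l u' = WΛ n l u' κ u) (hRs : ∀ n κ u l u', WR n κ u l u' = WR n l u' κ u)
    (hQs : ∀ n κ u l u', WQ n κ u l u' = WQ n l u' κ u)
    -- first-bond divergence-freeness of the gluon fine Hessian kernel AT THE RAY (the ghost Ward rows are theorems there)
    (hdiv : ∀ n : ℕ, 2 ≤ n → ∀ [NeZero n], ∀ (l' : Fin 4) (u' u : Site 4), ∑ κ' : Fin 4,
      (fineHess n a (SbfBal n a (cE n) (cVH n) (cΛ n) (cR n) (cgh n * (n : ℝ) ^ 2) (cgh n * a))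
          (Wbf (cE₂ n) (cJ4 n) (cΛ₂ n) (cR₂ n) (cQ₂ n) (WE n) (WJ n) (WΛ n) (WR n) (WQ n)) κ' l' (u - Pi.single κ' 1) u'
        - fineHess n a (SbfBal n a (cE n) (cVH n) (cΛ n) (cR n) (cgh n * (n : ℝ) ^ 2) (cgh n * a))
          (Wbf (cE₂ n) (cJ4 n) (cΛ₂ n) (cR₂ n) (cQ₂ n) (WE n) (WJ n) (WΛ n) (WR n) (WQ n)) κ' l' u u') = 0)
    -- (REST′) for the re-cut words other than the corner, n-UNIFORM; (U)
    (hRest : ∀ n : ℕ, 2 ≤ n → ∀ [NeZero n], ∀ τ : RestIdx, τ ≠ cornerIdx →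
      |∑ b ∈ (univ : Finset (Fin 4 → Fin n)).image resSite, ((n : ℝ) ^ 4)⁻¹ *
        fullSum (fun w : Pt => restKS n a (gfrz n a b) (fun v => s n * gfrz n a b v) (cE n) (cΛ n) (cR n) (cgh n * (n : ℝ) ^ 2) (cgh n * a) (cE₂ n) (cJ4 n) (cΛ₂ n) (cR₂ n)
          (cQ₂ n) (-cgh n) (WE n) (WJ n) (WΛ n) (WR n) (WQ n) (ωgl n) (ωgh n) ((n : ℝ) ^ 8) N μ ν b τ w)| ≤ CR τ)
    (hU : ∀ n : ℕ, 2 ≤ n → ∀ u, |Ru u n| ≤ CU u) :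
    D1Drift Lc Js N μ ν := by
  obtain ⟨δ₁, A₀, A₁, hδ₁, hA₀, hA₁, hd0, hd1⟩ := far_rows_d0_d1_of_prop12 ha h12 h126
  exact d1Drift_BFx_recut_ray_sbpS (A := tailConst A₀ A₁ 0) (δ := δ₁) Js hμν hN hL hodd ha c (tailConst_nonneg hA₀ hA₁ le_rfl) hδ₁ hd0 hd1 hB1
    (hGa_of_prop12 ha h12 h126) hK s hωs hlam hδW hE hJ hΛ hR hQ hEc hJc hΛc hRc hQc hEs hJs hΛs hRs hQs hdiv hRest hU

end Summit.QuantumFields.BalabanUV.Beta.D1BFx.RoadEndBFxRecutTailsSbpS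

end
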